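import Literature.MathematicalPhysics.QuantumLattice.EmeryThreeBandThermalClusterVectorFloor
import Literature.MathematicalPhysics.QuantumLattice.HubbardAtomicLimit
import Summits.Ventures.CertifiedManyBodySolver.Downfold.EmeryThermalSeam
import HarnessLib

/-!
# THE ATOMIC-LIMIT `T > 0` FLOOR of the three-band (Emery) pressure — a floor with the FULL entropy `6 log 2` per `CuO₂`,
# exact as `β → 0`, by Peierls' inequality on the OCCUPATION BASIS of the open `Cu₄O₈` block (pure algebra, zero kit)

Venture CertifiedManyBodySolver, cell `pub/hubbard-downfold` (S1 = ROUTER) × crew hubbard-fast S2 (ii) × (iv) «T > 0 × multi-band» (D-0096 (ii)); seat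
hubbard-downfold-mod-4 (S1/S2 Emery seam, g17). Namespace `Summit.Ventures.CertifiedManyBodySolver.Downfold`.

THE GAP IT CLOSES. Every two-sided `T > 0` three-band window of the tree (this seat's `EmeryBoxes<X>ThermalCapWord` / `…ThermalFloorAtlasWord` /
`…ThermalCentreWord`, hubbard-box-p1's re-tilted and Markov twins) pairs a CAP `6 log 2 + β·c` (full entropy) with a Rayleigh-FAMILY floor
`¼·log Σⱼ e^{−βCⱼ}` whose entropy is only `¼ log k` (k = 2, 3 members): at β = 0 the two sides differ by `6 log 2 − ¼ log k ≥ 3.88` nats per CuO₂ —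
the windows do not close at high temperature. Peierls' inequality `Σᵢ e^{−β Re⟨φᵢ, Hφᵢ⟩} ≤ Re Tr e^{−βH}` (hubbard-box-p1's device door
`log_sum_exp_rayleigh_le_emeryCellPressure`, any orthonormal family of `Cu₄O₈` cluster vectors) applied to the WHOLE OCCUPATION BASIS `|s⟩`, `s ⊆ Orb`,
of the 12-rank block gives the classical (atomic-limit) floor: the diagonal entries of the general-pair cluster `hubbardOpenBoxGP 1 12 τ υ ν` are the
on-site energies `Σ_x (υ_x·[x↑, x↓ ∈ s] + ν_x·([x↑ ∈ s] + [x↓ ∈ s]))` (§1: hopping has no diagonal), the Boltzmann sum FACTORISES over the twelve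
ranks (§3, the tree's `HubbardAtomicLimit` factorisation with site-dependent tables): **`¼·Σ_x log(1 + 2e^{−β ν_x} + e^{−β(2ν_x + υ_x)}) ≤ P_cell(β, θ)`**
for EVERY real β and EVERY θ (§3 `emeryCellPressure_atomicFloor`), i.e. on the physical line (4 Cu ranks at level `q₂` with `U_d = q₄`, 8 O ranks at
level `q₃` with `U_p = q₅`): **`log z(q₂, q₄) + 2·log z(q₃, q₅) ≤ P_cell(β, emeryLine s q)`**, `z(ε, U) = atomicPartitionFnReal β U (−ε) = 1 + 2e^{−βε} + e^{−β(2ε+U)}` (§4 `emeryCellPressure_line_atomicFloor`). At β = 0 both this floor and the cap equal `6 log 2`: paired with any cap word `6 log 2 + β·c` the window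
width is `O(β)` — THE FIRST `T > 0` THREE-BAND WINDOWS THAT CLOSE AT HIGH TEMPERATURE. §5: `z` is antitone in `(ε, U)` for `β ≥ 0`, so on a
typed box at reference level εp the floor is its value at the upper tail corner `(εp + Δ_hi, εp, U_d,hi, U_p,hi)` — the box door
**`holdsOn_emeryCellPressureAtomicFloor`** (entries + level, nothing else).

Everything PROVED (0 sorry); NO definition (the one-site partition function is the tree's `atomicPartitionFnReal β U μ` of `HubbardAtomicLimit`, read at `μ = −ε`). HONEST FRAMING: a law + door; the floor ignores hopping entirely (its β-slope is
the classical minimum energy, below the Rayleigh-family slopes by the kinetic binding), so it is the better floor only at small β (high T) —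
the word files quote `max(atomic, family)`; grand-canonical at a stated level; no phase word; no router number moves.
WHAT-THIS-IS-NOT: a certificate or a number of record; resolved thermal scales at physical temperatures.
-/

noncomputable section

namespace Summit.Ventures.CertifiedManyBodySolver.Downfold

open NonemptyInterval Matrix Finset Literature.Probability.LatticeModels
open Literature.MathematicalPhysics.QuantumLattice Literature.Computation.Certificates
open Summit.Ventures.CertifiedManyBodySolver.Certificates OccupationCode ClusterLowerBound HubbardWave0
open scoped BigOperators ComplexOrder

/-! ## §1 Diagonal entries of the general-pair cluster in the occupation basis -/

section Diagonal

variable {ι : Type*} [LinearOrder ι] [Fintype ι]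

/-- A hopping term has no diagonal: `(c†_i c_j)_{ss} = 0` for `i ≠ j`. [cite: Tasaki2020, §9.2] -/
theorem creation_mul_annihilation_apply_self_of_ne {i j : ι} (hij : i ≠ j) (s : Finset ι) :
    (creation i * annihilation j) s s = 0 := by
  rw [Matrix.mul_apply]
  refine Finset.sum_eq_zero fun u _ => ?_
  simp only [creation, conjTranspose_apply, annihilation]
  by_cases hj : (j ∉ u ∧ s = insert j u)
  · by_cases hi : (i ∉ u ∧ s = insert i u)
    · exfalso
      have h : i ∈ insert j u := by rw [← hj.2, hi.2]; exact Finset.mem_insert_self i u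
      rcases Finset.mem_insert.1 h with h | h
      · exact hij h
      · exact hi.1 h
    · rw [if_neg hi, star_zero, zero_mul]
  · rw [if_neg hj, mul_zero]

variable {a b : ℕ}

/-- **The diagonal of the general-pair cluster is the on-site energy**:
`(h^G)_{ss} = Σ_x (υ_x·[x↑ ∈ s ∧ x↓ ∈ s] + ν_x·([x↑ ∈ s] + [x↓ ∈ s]))`. [cite: Ueltschi1999, §3] [cite: ValentiStolzeHirschfeld1991, §II] -/
theorem hubbardOpenBoxGP_apply_self (τ : Fin a ×ₗ Fin b → Fin a ×ₗ Fin b → ℝ) (υ ν : Fin a ×ₗ Fin b → ℝ)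
    (s : Finset (Orb (Fin a ×ₗ Fin b))) :
    hubbardOpenBoxGP a b τ υ ν s s =
      ((∑ x : Fin a ×ₗ Fin b, (υ x * (if orb x 0 ∈ s ∧ orb x 1 ∈ s then 1 else 0) +
        ν x * ((if orb x 0 ∈ s then 1 else 0) + (if orb x 1 ∈ s then 1 else 0))) : ℝ) : ℂ) := by
  have hhop : (∑ x : Fin a ×ₗ Fin b, ∑ y : Fin a ×ₗ Fin b, ∑ σ : Fin 2,
      (if x ≠ y then ((τ x y : ℝ) : ℂ) • (creation (orb x σ) * annihilation (orb y σ))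
        else (0 : Matrix (Finset (Orb (Fin a ×ₗ Fin b))) (Finset (Orb (Fin a ×ₗ Fin b))) ℂ))) s s = 0 := by
    rw [Matrix.sum_apply]
    refine Finset.sum_eq_zero fun x _ => ?_
    rw [Matrix.sum_apply]
    refine Finset.sum_eq_zero fun y _ => ?_
    rw [Matrix.sum_apply]
    refine Finset.sum_eq_zero fun σ _ => ?_
    by_cases hxy : x ≠ y
    · rw [if_pos hxy, Matrix.smul_apply, creation_mul_annihilation_apply_self_of_ne (by
        intro h
        exact hxy (by simpa [orb] using congrArg (fun o => (ofLex o).1) h)), smul_zero]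
    · rw [if_neg hxy, Matrix.zero_apply]
  have hU : (∑ x : Fin a ×ₗ Fin b, ((υ x : ℝ) : ℂ) •
      (numberOp x 0 * numberOp x 1 : Matrix (Finset (Orb (Fin a ×ₗ Fin b))) (Finset (Orb (Fin a ×ₗ Fin b))) ℂ)) s s =
      ∑ x : Fin a ×ₗ Fin b, ((υ x : ℝ) : ℂ) * (if orb x 0 ∈ s ∧ orb x 1 ∈ s then 1 else 0) := by
    rw [Matrix.sum_apply]
    refine Finset.sum_congr rfl fun x _ => ?_
    rw [Matrix.smul_apply, numberOp_mul_numberOp_eq_diagonal, diagonal_apply_eq, smul_eq_mul]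
  have hN : (∑ x : Fin a ×ₗ Fin b, ((ν x : ℝ) : ℂ) •
      (numberOp x 0 + numberOp x 1 : Matrix (Finset (Orb (Fin a ×ₗ Fin b))) (Finset (Orb (Fin a ×ₗ Fin b))) ℂ)) s s =
      ∑ x : Fin a ×ₗ Fin b, ((ν x : ℝ) : ℂ) * ((if orb x 0 ∈ s then 1 else 0) + (if orb x 1 ∈ s then 1 else 0)) := by
    rw [Matrix.sum_apply]
    refine Finset.sum_congr rfl fun x _ => ?_
    rw [Matrix.smul_apply, Matrix.add_apply, smul_eq_mul]
    congr 1
    rw [numberOp, numberOp, ← numberAt, ← numberAt, numberAt_eq_diagonal, numberAt_eq_diagonal, diagonal_apply_eq, diagonal_apply_eq]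
  rw [hubbardOpenBoxGP, Matrix.add_apply, Matrix.add_apply, Matrix.neg_apply, hhop, hU, hN, neg_zero, zero_add]
  push_cast
  rw [← Finset.sum_add_distrib]
  refine Finset.sum_congr rfl fun x _ => ?_
  by_cases h0 : orb x 0 ∈ s <;> by_cases h1 : orb x 1 ∈ s <;> simp [h0, h1]

/-- The diagonal entry is real: its real part is the on-site energy. [cite: Ueltschi1999, §3] -/
theorem hubbardOpenBoxGP_apply_self_re (τ : Fin a ×ₗ Fin b → Fin a ×ₗ Fin b → ℝ) (υ ν : Fin a ×ₗ Fin b → ℝ)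
    (s : Finset (Orb (Fin a ×ₗ Fin b))) :
    (hubbardOpenBoxGP a b τ υ ν s s).re =
      ∑ x : Fin a ×ₗ Fin b, (υ x * (if orb x 0 ∈ s ∧ orb x 1 ∈ s then 1 else 0) +
        ν x * ((if orb x 0 ∈ s then 1 else 0) + (if orb x 1 ∈ s then 1 else 0))) := by
  rw [hubbardOpenBoxGP_apply_self, Complex.ofReal_re]

end Diagonal

/-! ## §2 Peierls on the occupation basis -/

section Basis

variable {ι : Type*} [DecidableEq ι]

/-- The occupation basis is orthonormal. [folklore] -/
theorem occBasis_orthonormal (s t : Finset ι) [Fintype (Finset ι)] :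
    star (Pi.single s (1 : ℂ) : Finset ι → ℂ) ⬝ᵥ (Pi.single t (1 : ℂ)) = if s = t then 1 else 0 := by
  have hstar : star (Pi.single s (1 : ℂ) : Finset ι → ℂ) = Pi.single s 1 := by
    ext u
    by_cases h : u = s
    · subst h; simp
    · simp [h]
  rw [hstar, single_dotProduct, one_mul, Pi.single_apply]

/-- The Rayleigh quotient of a basis vector is the diagonal entry. [folklore] -/
theorem occBasis_rayleigh [Fintype (Finset ι)] (M : Matrix (Finset ι) (Finset ι) ℂ) (s : Finset ι) :
    star (Pi.single s (1 : ℂ) : Finset ι → ℂ) ⬝ᵥ (M *ᵥ Pi.single s (1 : ℂ)) = M s s := by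
  have hstar : star (Pi.single s (1 : ℂ) : Finset ι → ℂ) = Pi.single s 1 := by
    ext u
    by_cases h : u = s
    · subst h; simp
    · simp [h]
  rw [hstar, single_dotProduct, one_mul, Matrix.mulVec_single]
  simp

end Basis

/-- **PEIERLS ON THE WHOLE OCCUPATION BASIS of the `Cu₄O₈` block** (every real β, every θ):
`log Σ_s exp(−β·(h^G_θ)_{ss}) ≤ 4·P_cell(β, θ)`. [cite: Ruelle1969, §2.5–2.6] [cite: Israel1979, Lemma II.3.1] -/
theorem log_sum_exp_diag_le_emeryCellPressure (β : ℝ) (θ : Fin 14 → ℝ) :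
    Real.log (∑ s : Finset (Orb (Fin 1 ×ₗ Fin 12)),
      Real.exp (-(β * (hubbardOpenBoxGP 1 12 (blockTau θ) (blockUps θ) (blockNu θ) s s).re))) ≤ 4 * emeryCellPressure β θ := by
  have h := log_sum_exp_rayleigh_le_emeryCellPressure β θ (ι := Finset (Orb (Fin 1 ×ₗ Fin 12)))
    (φ := fun s => (Pi.single s (1 : ℂ) : Fock (Orb (Fin 1 ×ₗ Fin 12)))) (fun s t => occBasis_orthonormal s t)
  simp only [occBasis_rayleigh] at h
  exact h

/-! ## §3 Factorisation over the twelve ranks -/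

/-! The one-site grand partition function is the tree's `atomicPartitionFnReal β U μ = 1 + 2e^{βμ} + e^{−β(U − 2μ)}` (`HubbardAtomicLimit`,
Ueltschi's `e^{−βf₀}`), read at chemical potential `μ = −ε` for a site at level `ε`: `z(β; ε, U) = atomicPartitionFnReal β U (−ε) = 1 + 2e^{−βε} + e^{−β(2ε+U)}`. -/

/-- At `β = 0` the one-site partition function is `4` (the full one-site entropy `log 4`). [cite: Ueltschi1999, §3] -/
theorem atomicPartitionFnReal_beta_zero (U μ : ℝ) : atomicPartitionFnReal 0 U μ = 4 := by
  simp [atomicPartitionFnReal]; norm_num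

/-- The one-site partition function is monotone in the chemical potential and antitone in the repulsion (`β ≥ 0`). [folklore] -/
theorem atomicPartitionFnReal_mono {β : ℝ} (hβ : 0 ≤ β) {U U' μ μ' : ℝ} (hμ : μ ≤ μ') (hU : U' ≤ U) :
    atomicPartitionFnReal β U μ ≤ atomicPartitionFnReal β U' μ' := by
  unfold atomicPartitionFnReal
  have h1 : Real.exp (β * μ) ≤ Real.exp (β * μ') := Real.exp_le_exp.2 (by nlinarith)
  have h2 : Real.exp (-(β * (U - 2 * μ))) ≤ Real.exp (-(β * (U' - 2 * μ'))) := Real.exp_le_exp.2 (by nlinarith)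
  linarith

section Factorisation

variable {Λ : Type*} [LinearOrder Λ] [Fintype Λ]

/-- One binary degree of freedom per site, site-dependent tables (Mathlib's `Fintype.prod_add` read backwards). [folklore] -/
private theorem sum_prod_ite_mem_eq_prod_add' {R : Type*} [CommSemiring R] (f g : Λ → R) :
    (∑ B : Finset Λ, ∏ x, if x ∈ B then f x else g x) = ∏ x, (f x + g x) := by
  classical
  rw [Fintype.prod_add]
  refine Finset.sum_congr rfl fun B _ => ?_
  rw [Finset.prod_ite]
  congr 1
  · rw [Finset.filter_mem_eq_inter, Finset.univ_inter]
  · congr 1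
    ext x
    simp [Finset.mem_compl]

/-- **Two binary degrees of freedom per site, SITE-DEPENDENT tables**: `Σ_{A, B ⊆ Λ} Π_x φ_x(x ∈ A, x ∈ B) = Π_x (φ_x(1,1) + φ_x(1,0) + φ_x(0,1) + φ_x(0,0))`
(the `HubbardAtomicLimit` factorisation `sum_sum_prod_eq_pow` with an inhomogeneous table). [cite: Ueltschi1999, §2.1] -/
theorem sum_sum_prod_eq_prod (φ : Λ → Bool → Bool → ℝ) :
    (∑ A : Finset Λ, ∑ B : Finset Λ, ∏ x, φ x (decide (x ∈ A)) (decide (x ∈ B))) =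
      ∏ x, (φ x true true + φ x true false + φ x false true + φ x false false) := by
  classical
  have inner : ∀ A : Finset Λ, (∑ B : Finset Λ, ∏ x, φ x (decide (x ∈ A)) (decide (x ∈ B))) =
      ∏ x, (φ x (decide (x ∈ A)) true + φ x (decide (x ∈ A)) false) := by
    intro A
    rw [← sum_prod_ite_mem_eq_prod_add']
    refine Finset.sum_congr rfl fun B _ => Finset.prod_congr rfl fun x _ => ?_
    by_cases hx : x ∈ B <;> simp [hx]
  simp_rw [inner]
  have outer : (∑ A : Finset Λ, ∏ x, (φ x (decide (x ∈ A)) true + φ x (decide (x ∈ A)) false)) =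
      ∏ x, ((φ x true true + φ x true false) + (φ x false true + φ x false false)) := by
    rw [← sum_prod_ite_mem_eq_prod_add' (fun x => φ x true true + φ x true false) (fun x => φ x false true + φ x false false)]
    refine Finset.sum_congr rfl fun A _ => Finset.prod_congr rfl fun x _ => ?_
    by_cases hx : x ∈ A <;> simp [hx]
  rw [outer]
  exact Finset.prod_congr rfl fun x _ => by ring

variable {a b : ℕ}

/-- **THE CLASSICAL BOLTZMANN SUM FACTORISES**: `Σ_s exp(−β·(h^G)_{ss}) = Π_x z₀(β; υ_x, −ν_x)`. [cite: Ueltschi1999, §3] -/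
theorem sum_exp_neg_diag_eq_prod_atomicPartitionFnReal (β : ℝ) (τ : Fin a ×ₗ Fin b → Fin a ×ₗ Fin b → ℝ) (υ ν : Fin a ×ₗ Fin b → ℝ) :
    (∑ s : Finset (Orb (Fin a ×ₗ Fin b)), Real.exp (-(β * (hubbardOpenBoxGP a b τ υ ν s s).re))) =
      ∏ x : Fin a ×ₗ Fin b, atomicPartitionFnReal β (υ x) (-ν x) := by
  classical
  -- the Boltzmann factor of `s` as a product over sites of a site table read at (x↑ ∈ s, x↓ ∈ s)
  let φ : Fin a ×ₗ Fin b → Bool → Bool → ℝ := fun x u d =>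
    match u, d with
    | true, true => Real.exp (-(β * (υ x - 2 * -ν x)))
    | true, false => Real.exp (β * -ν x)
    | false, true => Real.exp (β * -ν x)
    | false, false => 1
  have hfac : ∀ s : Finset (Orb (Fin a ×ₗ Fin b)), Real.exp (-(β * (hubbardOpenBoxGP a b τ υ ν s s).re)) =
      ∏ x, φ x (decide (x ∈ upPart s)) (decide (x ∈ downPart s)) := by
    intro s
    rw [hubbardOpenBoxGP_apply_self_re, Finset.mul_sum, ← Finset.sum_neg_distrib, Real.exp_sum]
    refine Finset.prod_congr rfl fun x _ => ?_
    by_cases h0 : orb x 0 ∈ s <;> by_cases h1 : orb x 1 ∈ s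
    · simp only [φ, h0, h1, mem_upPart, mem_downPart, decide_true, and_self, ite_true]
      congr 1
      ring
    · simp [φ, h0, h1]
    · simp [φ, h0, h1]
    · simp [φ, h0, h1]
  simp_rw [hfac]
  have h1 : (∑ s : Finset (Orb (Fin a ×ₗ Fin b)), ∏ x, φ x (decide (x ∈ upPart s)) (decide (x ∈ downPart s))) =
      ∑ p : Finset (Fin a ×ₗ Fin b) × Finset (Fin a ×ₗ Fin b), ∏ x, φ x (decide (x ∈ p.1)) (decide (x ∈ p.2)) := by
    rw [← (configEquiv (Λ := Fin a ×ₗ Fin b)).symm.sum_comp]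
    refine Finset.sum_congr rfl fun p _ => ?_
    simp [configEquiv]
  rw [h1, Fintype.sum_prod_type, sum_sum_prod_eq_prod]
  refine Finset.prod_congr rfl fun x _ => ?_
  simp only [φ, atomicPartitionFnReal]
  ring

end Factorisation

/-- **THE ATOMIC-LIMIT FLOOR** (every real β, every θ ∈ ℝ¹⁴): `¼ · Σ_x log z(β; ν_x(θ), υ_x(θ)) ≤ P_cell(β, θ)` with the block's `θ`-combined
site tables `ν = blockNu θ`, `υ = blockUps θ` over the twelve ranks of `Cu₄O₈`. [cite: Ruelle1969, §2.5–2.6] [cite: Ueltschi1999, §3] -/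
theorem emeryCellPressure_atomicFloor (β : ℝ) (θ : Fin 14 → ℝ) :
    (∑ x : Fin 1 ×ₗ Fin 12, Real.log (atomicPartitionFnReal β (blockUps θ x) (-blockNu θ x))) / 4 ≤ emeryCellPressure β θ := by
  have h := log_sum_exp_diag_le_emeryCellPressure β θ
  rw [sum_exp_neg_diag_eq_prod_atomicPartitionFnReal, Real.log_prod (fun x _ => (atomicPartitionFnReal_pos β _ _).ne')] at h
  linarith

/-! ## §4 On the physical line: four Cu ranks at `(q₂, q₄)`, eight O ranks at `(q₃, q₅)` -/

/-- The `θ`-combined site-energy table is the level of the rank's species. [cite: PavariniEtAl2001, eq. (1)] -/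
theorem blockNu_eq (θ : Fin 14 → ℝ) (i : Fin 1 ×ₗ Fin 12) : blockNu θ i = θ (cu4o8EpsAtomOf (ofLex i).2) := by
  unfold blockNu cu4o8Nu
  simp [Finset.sum_ite_eq']

/-- The `θ`-combined repulsion table is the repulsion of the rank's species. [cite: PavariniEtAl2001, eq. (1)] -/
theorem blockUps_eq (θ : Fin 14 → ℝ) (i : Fin 1 ×ₗ Fin 12) : blockUps θ i = θ (cu4o8UAtomOf (ofLex i).2) := by
  unfold blockUps cu4o8Ups
  simp [Finset.sum_ite_eq']

/-- A sum over `Fin 1 ×ₗ Fin 12` is the sum over the second coordinate. [folklore] -/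
theorem sum_lex_fin_one (f : Fin 1 ×ₗ Fin 12 → ℝ) : (∑ i : Fin 1 ×ₗ Fin 12, f i) = ∑ k : Fin 12, f (toLex (0, k)) := by
  rw [← Equiv.sum_comp (toLex : Fin 1 × Fin 12 ≃ Fin 1 ×ₗ Fin 12) f, Fintype.sum_prod_type, Fin.sum_univ_one]

/-- The site-energy table on the line, by rank: Cu ranks `0, 2, 6, 8` at `q₂`, O ranks at `q₃`. [cite: PavariniEtAl2001, eq. (1)] -/
theorem blockNu_line (s : Fin 4 → ℝ) (q : Fin 6 → ℝ) (k : Fin 12) :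
    blockNu (emeryLine s q) (toLex ((0 : Fin 1), k)) = (![q 2, q 3, q 2, q 3, q 3, q 3, q 2, q 3, q 2, q 3, q 3, q 3] : Fin 12 → ℝ) k := by
  rw [blockNu_eq]
  fin_cases k <;> rfl

/-- The repulsion table on the line, by rank: Cu ranks at `q₄`, O ranks at `q₅`. [cite: PavariniEtAl2001, eq. (1)] -/
theorem blockUps_line (s : Fin 4 → ℝ) (q : Fin 6 → ℝ) (k : Fin 12) :
    blockUps (emeryLine s q) (toLex ((0 : Fin 1), k)) = (![q 4, q 5, q 4, q 5, q 5, q 5, q 4, q 5, q 4, q 5, q 5, q 5] : Fin 12 → ℝ) k := by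
  rw [blockUps_eq]
  fin_cases k <;> rfl

/-- **THE ATOMIC-LIMIT FLOOR ON THE PHYSICAL LINE** (every real β, every sign pattern `s`, every `q`):
`log z(β; q₂, q₄) + 2·log z(β; q₃, q₅) ≤ P_cell(β, emeryLine s q)` — four Cu ranks at level `q₂ = ε_d` with `U_d = q₄`, eight O ranks at level
`q₃ = ε_p` with `U_p = q₅`; the hoppings `q₀, q₁` do not enter. At β = 0 the left side is `6 log 2`. [cite: Ruelle1969, §2.5–2.6] [cite: Ueltschi1999, §3] -/
theorem emeryCellPressure_line_atomicFloor (β : ℝ) (s : Fin 4 → ℝ) (q : Fin 6 → ℝ) :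
    Real.log (atomicPartitionFnReal β (q 4) (-q 2)) + 2 * Real.log (atomicPartitionFnReal β (q 5) (-q 3)) ≤ emeryCellPressure β (emeryLine s q) := by
  have h := emeryCellPressure_atomicFloor β (emeryLine s q)
  rw [sum_lex_fin_one] at h
  simp only [blockNu_line, blockUps_line, Fin.sum_univ_succ, Fin.sum_univ_zero, Matrix.cons_val_zero, Matrix.cons_val_succ] at h
  linarith

/-- The same floor with its `β = 0` value displayed: at infinite temperature the floor is `6 log 2` per `CuO₂` (= the cap constant of every cap word).
[cite: Ueltschi1999, §3] -/
theorem emeryCellPressure_line_atomicFloor_zero (s : Fin 4 → ℝ) (q : Fin 6 → ℝ) :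
    6 * Real.log 2 ≤ emeryCellPressure 0 (emeryLine s q) := by
  have h := emeryCellPressure_line_atomicFloor 0 s q
  rw [atomicPartitionFnReal_beta_zero, atomicPartitionFnReal_beta_zero, show (4 : ℝ) = 2 ^ 2 by norm_num, Real.log_pow] at h
  push_cast at h
  linarith

/-! ## §5 The box door -/

/-- **THE ATOMIC-LIMIT FLOOR ON A TYPED EMERY BOX** (`β ≥ 0`, reference level εp, nothing but the five entries): at every point of the box
`log z(β; εp + Δ_hi, U_d,hi) + 2·log z(β; εp, U_p,hi) ≤ P_cell(β, emeryLine s (emeryLineCoords εp p))` — the floor's value at the upper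
tail corner binds the box (antitone in `(ε, U)`). [cite: Ruelle1969, §2.5–2.6] [cite: Ueltschi1999, §3] -/
theorem holdsOn_emeryCellPressureAtomicFloor {E : EmeryBox} {eA eB eD eUd eUp : Entry} (εp : ℚ)
    (hA : E .tpd = some eA) (hB : E .tpp = some eB) (hD : E .DeltaPd = some eD)
    (hUd : E .Udd = some eUd) (hUp : E .Upp = some eUp) (s : Fin 4 → ℝ) {β : ℝ} (hβ : 0 ≤ β) :
    HoldsOn (fun p : EmeryCoord → ℝ =>
      Real.log (atomicPartitionFnReal β (((eUd.encl.snd : ℚ) : ℝ)) (-(((εp + eD.encl.snd : ℚ) : ℝ)))) +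
        2 * Real.log (atomicPartitionFnReal β (((eUp.encl.snd : ℚ) : ℝ)) (-((εp : ℚ) : ℝ))) ≤
        emeryCellPressure β (emeryLine s (emeryLineCoords (εp : ℝ) p))) E := by
  intro p hp
  have hq := emeryLineCoords_mem_Icc (εp := εp) hA hB hD hUd hUp hp
  have h2 : emeryLineCoords (εp : ℝ) p 2 ≤ ((εp + eD.encl.snd : ℚ) : ℝ) := by simpa [emeryHi] using hq.2 2
  have h3 : emeryLineCoords (εp : ℝ) p 3 = ((εp : ℚ) : ℝ) := rfl
  have h4 : emeryLineCoords (εp : ℝ) p 4 ≤ ((eUd.encl.snd : ℚ) : ℝ) := by simpa [emeryHi] using hq.2 4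
  have h5 : emeryLineCoords (εp : ℝ) p 5 ≤ ((eUp.encl.snd : ℚ) : ℝ) := by simpa [emeryHi] using hq.2 5
  refine le_trans ?_ (emeryCellPressure_line_atomicFloor β s _)
  have m1 := Real.log_le_log (atomicPartitionFnReal_pos β _ _) (atomicPartitionFnReal_mono hβ (neg_le_neg h2) h4)
  have m2 := Real.log_le_log (atomicPartitionFnReal_pos β _ _) (atomicPartitionFnReal_mono hβ (neg_le_neg h3.le) h5)
  linarith

/-- **At a point**: the floor at a single line vector (for the centre / corner / named-point words). [cite: Ueltschi1999, §3] -/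
theorem emeryCellPressure_point_atomicFloor (β : ℝ) (s : Fin 4 → ℝ) (q : Fin 6 → ℝ) {εd εp Ud Up : ℝ}
    (h2 : q 2 = εd) (h3 : q 3 = εp) (h4 : q 4 = Ud) (h5 : q 5 = Up) :
    Real.log (atomicPartitionFnReal β Ud (-εd)) + 2 * Real.log (atomicPartitionFnReal β Up (-εp)) ≤ emeryCellPressure β (emeryLine s q) := by
  subst h2 h3 h4 h5
  exact emeryCellPressure_line_atomicFloor β s q

end Summit.Ventures.CertifiedManyBodySolver.Downfold

end
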